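import Literature.Analysis.FluidPDE.Seregin2020ScaledEnergyBounds
import Literature.Analysis.FluidPDE.CKNInterpolationEstimate

/-!
# Crux `SelfMixingDichotomy.SequentialTypeIExclusion` (stmt-NavierStokesRegularity-1424), line `registered` (r4):
  sub-goal `cknC_gap_growth_three_halves` of the STUB `stub_windowsForceTypeI` — helper file (`--supports`)

The registered stub `stub_windowsForceTypeI` asks whether Type-I WINDOWS of the cubic functional
`C(r; z) = r⁻² ∬_{Q_r(z)} |u|³` (`C = cknC`, backward parabolic cylinders `Q_r(z)`) along a
sequence of scales `r_k → 0` force a Type-I BOUND `C(ρ; z) ≤ M'` at all small scales `ρ`.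
Trivially `C(ρ) ≤ (r/ρ)² C(r)` for `ρ ≤ r` (sub-cylinder). This file machine-checks the best
control between a window scale `r` and an arbitrary `ρ ∈ (0, r/2]` that the local energy
inequality gives for a suitable weak solution: the exponent `2` improves to `3/2`,

`C(ρ) ≤ K₀ (r/ρ)^{3/2} (C(r)^{2/3} + C(r) + D(r)^{2/3} C(r)^{1/3})^{3/2}`.

Proof (all ingredients proved in the tree):

1. the local energy bound at cylinders touching the top of the domain
   (`Seregin2020.localEnergyBound_top`):
   `A(r/2) + E(r/2) ≤ c₁ C(r)^{2/3} + c₂ C(r) + c₃ D(r)^{2/3} C(r)^{1/3}`;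
2. monotonicity of `A = cknAEss` and `E = cknE` in the radius
   (`cknAEss_le_mul_of_subset`, `cknE_le_mul_of_subset`): for `ρ ≤ r/2`,
   `A(ρ) + E(ρ) ≤ ((r/2)/ρ) (A(r/2) + E(r/2))`;
3. the CKN interpolation inequality `C(ρ) ≤ C₀ (A(ρ) + E(ρ))^{3/2}` (`exists_cknC_le_rpow`;
   Robinson–Rodrigo–Sadowski 2016, Lemma 15.10);
4. algebra in `ℝ≥0∞`.
-/

noncomputable section

-- the summit and its single problem share the name (D-0017 nested layout)
set_option linter.dupNamespace false

namespace Summit.NavierStokesRegularity.NavierStokesRegularity.Theorems.SequentialTypeIExclusion.Registered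

open scoped ENNReal NNReal Topology
open Literature.Analysis.FluidPDE Set Filter MeasureTheory Function Metric TopologicalSpace

/-- **Monotonicity of `A + E` in the radius, real-ratio form.** For `0 < ρ ≤ R` and any centre
`z`, `A(ρ; z) + E(ρ; z) ≤ (R/ρ) (A(R; z) + E(R; z))` (`A = cknAEss`, `E = cknE`; the time window
and ball of `Q_ρ(z)` lie in those of `Q_R(z)`, and `ρ⁻¹ = (R/ρ) R⁻¹`). -/
theorem cknAEss_add_cknE_le_mul_of_le {ρ R : ℝ} (hρ : 0 < ρ) (hρR : ρ ≤ R)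
    (z : ℝ × EuclideanSpace ℝ (Fin 3))
    (u : ℝ → EuclideanSpace ℝ (Fin 3) → EuclideanSpace ℝ (Fin 3))
    (G : ℝ → EuclideanSpace ℝ (Fin 3) → EuclideanSpace ℝ (Fin 3) →L[ℝ] EuclideanSpace ℝ (Fin 3)) :
    cknAEss ρ z u + cknE ρ z G ≤ ENNReal.ofReal (R / ρ) * (cknAEss R z u + cknE R z G) := by
  have hR : 0 < R := hρ.trans_le hρR
  have h2 : ρ ^ 2 ≤ R ^ 2 := pow_le_pow_left₀ hρ.le hρR 2
  have hI : Ioo (z.1 - ρ ^ 2) z.1 ⊆ Ioo (z.1 - R ^ 2) z.1 := Ioo_subset_Ioo (by linarith) le_rfl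
  rw [mul_add]
  exact add_le_add (cknAEss_le_mul_of_subset hR hρ hI (ball_subset_ball hρR) u)
    (cknE_le_mul_of_subset hR hρ (parabolicCylinder_mono hρ.le hρR z) G)

/-- **Gap growth with exponent `3/2`.** There is an absolute constant `K₀` such that for every
suitable weak solution `(u, p)` of the unforced Navier–Stokes equations (`ν = 1`) on an open
`Q ⊆ ℝ × ℝ³`, every weak spatial gradient `G` of `u` on `Q`, every backward cylinder
`Q_r(z) ⊆ Q` with `C(r; z), D(r; z) < ∞` and every `ρ ∈ (0, r/2]`,
`C(ρ; z) ≤ K₀ (r/ρ)^{3/2} (C(r)^{2/3} + C(r) + D(r)^{2/3} C(r)^{1/3})^{3/2}`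
(`C = cknC`, `D = cknD`). Local energy bound at the top (`Seregin2020.localEnergyBound_top`),
monotonicity of `A + E` down to `ρ`, and the CKN interpolation inequality
(`exists_cknC_le_rpow`). -/
theorem cknC_gap_growth_three_halves : ∃ K₀ : NNReal, ∀ (Q : TopologicalSpace.Opens (ℝ × EuclideanSpace ℝ (Fin 3))) (u : ℝ → EuclideanSpace ℝ (Fin 3) → EuclideanSpace ℝ (Fin 3)) (p : ℝ → EuclideanSpace ℝ (Fin 3) → ℝ) (G : ℝ → EuclideanSpace ℝ (Fin 3) → EuclideanSpace ℝ (Fin 3) →L[ℝ] EuclideanSpace ℝ (Fin 3)), Literature.Analysis.FluidPDE.IsSuitableWeakSolutionOn Q 1 0 u p → Literature.Analysis.FluidPDE.HasWeakSpatialGradientOn Q u G → ∀ (z : ℝ × EuclideanSpace ℝ (Fin 3)) (r : ℝ), 0 < r → Literature.Analysis.FluidPDE.parabolicCylinder r z ⊆ (Q : Set (ℝ × EuclideanSpace ℝ (Fin 3))) → Literature.Analysis.FluidPDE.cknC r z u ≠ ⊤ → Literature.Analysis.FluidPDE.cknD r z p ≠ ⊤ → ∀ ρ ∈ Set.Ioc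 0 (r / 2), Literature.Analysis.FluidPDE.cknC ρ z u ≤ K₀ * ENNReal.ofReal ((r / ρ) ^ (3 / 2 : ℝ)) * (Literature.Analysis.FluidPDE.cknC r z u ^ (2 / 3 : ℝ) + Literature.Analysis.FluidPDE.cknC r z u + Literature.Analysis.FluidPDE.cknD r z p ^ (2 / 3 : ℝ) * Literature.Analysis.FluidPDE.cknC r z u ^ (1 / 3 : ℝ)) ^ (3 / 2 : ℝ) := by
  obtain ⟨c₁, c₂, c₃, HT⟩ := Seregin2020.localEnergyBound_top
  obtain ⟨C₀, HI⟩ := exists_cknC_le_rpow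
  -- a common bound `m` for the three constants of the local energy bound
  obtain ⟨m, hc₁, hc₂, hc₃⟩ : ∃ m : ℝ≥0, (c₁ : ℝ≥0∞) ≤ m ∧ (c₂ : ℝ≥0∞) ≤ m ∧ (c₃ : ℝ≥0∞) ≤ m :=
    ⟨max (max c₁ c₂) c₃, ENNReal.coe_le_coe.2 (le_max_of_le_left (le_max_left _ _)),
      ENNReal.coe_le_coe.2 (le_max_of_le_left (le_max_right _ _)),
      ENNReal.coe_le_coe.2 (le_max_right _ _)⟩
  refine ⟨C₀ * m ^ (3 / 2 : ℝ), fun Q u p G hsw hG z r hr hQ hCtop hDtop ρ hρ => ?_⟩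
  have hρ0 : 0 < ρ := hρ.1
  have hρr : ρ ≤ r := hρ.2.trans (by linarith)
  -- ### Step 1: the local energy bound at the top, `A(r/2) + E(r/2) ≤ m S`
  have hLEB := HT Q u p G hsw hG z r hr hQ
  set C := cknC r z u with hC
  set D := cknD r z p with hD
  set S : ℝ≥0∞ := C ^ (2 / 3 : ℝ) + C + D ^ (2 / 3 : ℝ) * C ^ (1 / 3 : ℝ) with hS
  have hAE : cknAEss (r / 2) z u + cknE (r / 2) z G ≤ m * S := by
    refine hLEB.trans ?_
    calc (c₁ : ℝ≥0∞) * C ^ (2 / 3 : ℝ) + c₂ * C + c₃ * (D ^ (2 / 3 : ℝ) * C ^ (1 / 3 : ℝ))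
        ≤ (m : ℝ≥0∞) * C ^ (2 / 3 : ℝ) + m * C + m * (D ^ (2 / 3 : ℝ) * C ^ (1 / 3 : ℝ)) := by
          gcongr
      _ = m * S := by rw [hS]; ring
  -- ### Step 2: monotonicity down to the radius `ρ ≤ r/2`
  have hAEρ : cknAEss ρ z u + cknE ρ z G ≤ ENNReal.ofReal (r / ρ) * (m * S) := by
    calc cknAEss ρ z u + cknE ρ z G
        ≤ ENNReal.ofReal ((r / 2) / ρ) * (cknAEss (r / 2) z u + cknE (r / 2) z G) :=
          cknAEss_add_cknE_le_mul_of_le hρ0 hρ.2 z u G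
      _ ≤ ENNReal.ofReal (r / ρ) * (m * S) := by
          gcongr
          linarith
  -- ### Step 3: finiteness of `A(ρ)` and `E(ρ)`
  have hC23 : C ^ (2 / 3 : ℝ) ≠ ∞ := ENNReal.rpow_ne_top_of_nonneg (by norm_num) hCtop
  have hC13 : C ^ (1 / 3 : ℝ) ≠ ∞ := ENNReal.rpow_ne_top_of_nonneg (by norm_num) hCtop
  have hD23 : D ^ (2 / 3 : ℝ) ≠ ∞ := ENNReal.rpow_ne_top_of_nonneg (by norm_num) hDtop
  have hStop : S ≠ ∞ :=
    ENNReal.add_ne_top.2 ⟨ENNReal.add_ne_top.2 ⟨hC23, hCtop⟩, ENNReal.mul_ne_top hD23 hC13⟩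
  have hfin : cknAEss ρ z u + cknE ρ z G ≠ ∞ :=
    ne_top_of_le_ne_top (ENNReal.mul_ne_top ENNReal.ofReal_ne_top
      (ENNReal.mul_ne_top ENNReal.coe_ne_top hStop)) hAEρ
  have hAtop : cknAEss ρ z u ≠ ∞ := ne_top_of_le_ne_top hfin le_self_add
  have hEtop : cknE ρ z G ≠ ∞ := ne_top_of_le_ne_top hfin le_add_self
  -- ### Step 4: the weak gradient on `Q_ρ(z) ⊆ Q` and the interpolation inequality
  have hle : parabolicCylinderOpens ρ z ≤ Q := by
    intro w hw
    exact hQ (parabolicCylinder_mono hρ0.le hρr z hw)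
  have key := HI u G z ρ hρ0 (hG.mono hle) hAtop hEtop
  -- ### Step 5: algebra in `ℝ≥0∞`
  calc cknC ρ z u ≤ C₀ * (cknAEss ρ z u + cknE ρ z G) ^ (3 / 2 : ℝ) := key
    _ ≤ C₀ * (ENNReal.ofReal (r / ρ) * (m * S)) ^ (3 / 2 : ℝ) := by gcongr
    _ = ((C₀ * m ^ (3 / 2 : ℝ) : ℝ≥0) : ℝ≥0∞) * ENNReal.ofReal ((r / ρ) ^ (3 / 2 : ℝ)) *
          S ^ (3 / 2 : ℝ) := by
        rw [ENNReal.mul_rpow_of_nonneg _ _ (by norm_num : (0 : ℝ) ≤ 3 / 2),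
          ENNReal.mul_rpow_of_nonneg _ _ (by norm_num : (0 : ℝ) ≤ 3 / 2),
          ENNReal.ofReal_rpow_of_pos (div_pos hr hρ0), ENNReal.coe_mul,
          ENNReal.coe_rpow_of_nonneg _ (by norm_num : (0 : ℝ) ≤ 3 / 2)]
        ring

end Summit.NavierStokesRegularity.NavierStokesRegularity.Theorems.SequentialTypeIExclusion.Registered
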